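import Mathlib
import Summits.PneNP.PneNP.Theorems.CnfIdealGenLengthRankDefectRepresentationsQuadrantCapture
import Literature.LinearAlgebra.Matrix.CrossInterpolation

/-!
# Crux `RankDefectRepresentations` (stmt-PneNP-18923), line `rank-dehn-ladder`: STAIRCASE CAP (registered stub `stub_staircaseCap`,
# lead g16 RESHAPE 14, W14; brief `Cruxes/RankDefectRepresentations/Lines/rank-dehn-ladder-briefs-g16b.md` §W14)

A WEAK STAIRCASE of length `ℓ` in a two-family instance `D` (rows and columns coloured by `{0,1}^n × {0,1}^{n'}`; a cell is visible iff
the first-family colours differ AND the second-family colours differ) is a sequence of cells `(s i, t i)`, `i < ℓ`, with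
`D (s i) (t i) ≠ 0`, `D (s i) (t j) = 0` for `j < i`, and `(s i, t j)` visible for `j ≤ i`.  Such a configuration certifies rank `≥ ℓ`
for every completion of `D`.  This file proves the universal CAP in the average currency of the line (memo
`Lines/rank-dehn-ladder-g16.md` §2–§3): `ℓ · 2^{2^n} · 2^{2^{n'}} ≤ 4 · Σ_{A,A'} doubleCut A A' D`, i.e. `ℓ ≤ 4 ē(D)`
(`stub_staircaseCap`).

Proof.  (1) For a double cut `(A, A')` and a sign pattern `(σ, τ)`, the diagonal cells whose row has pattern `(σ, τ)` (membership of
its two colours in `A`, `A'`) and whose column has the opposite pattern form a unitriangular submatrix of the rectangle matrix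
`rect row col A A' σ τ D` of `…QuadrantCapture`, so their number is at most its rank (`card_le_rank_of_staircase`,
`card_filter_pattern_le_rank_rect`; a nonsingular `k × k` submatrix forces rank `≥ k`,
`Literature.LinearAlgebra.Matrix.card_le_rank_of_isUnit_det_submatrix`).  (2) Summing over the four patterns
(`doubleCut_eq_sum_four`), the number of diagonal cells SEPARATED by `(A, A')` in both families is at most `doubleCut A A' D`
(`card_filter_sep_le_doubleCut`).  (3) Double counting (`sum_sum_card_filter_and`): each diagonal cell is separated by exactly
`2^{2^n - 1} · 2^{2^{n'} - 1}` double cuts, because exactly half of all sets separate two distinct points — toggling one of them is an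
involution exchanging separating and non-separating sets (`two_mul_card_filter_sep`) — and the diagonal cells are visible.  Only the
case `j = i` of the visibility hypothesis is used.
HONEST FRAMING: elementary negative-lane tool; the lead's stubs and the crux stay open; P ≠ NP is not moved; F-N2 is a FRONTIER formal
rung.
-/

set_option linter.dupNamespace false -- `Summit.PneNP.PneNP.…`: summit = sub-problem name (D-0017)

namespace Summit.PneNP.PneNP.Theorems.CnfIdealGenLengthRankDefectRepresentationsStaircaseCap

open Matrix Finset
open Summit.PneNP.PneNP.Theorems.CnfIdealGenLengthRankDefectRepresentationsTwoFamilyCutDomination (colourI colourJ doubleCut)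
open Summit.PneNP.PneNP.Theorems.CnfIdealGenLengthRankDefectRepresentationsQuadrantCapture (rect rect_apply doubleCut_eq_sum_four)
open Literature.LinearAlgebra.Matrix (card_le_rank_of_isUnit_det_submatrix)

/-! ## Unitriangular witnesses of rank -/

section Staircase

variable {K : Type} [Field K]

/-- **Staircase minor.**  If the cells `(s i, t i)`, `i ∈ I`, of a matrix `R` over a field are non-zero and `R (s i) (t j) = 0`
for `j < i` in `I`, then `#I ≤ rank R`: the `I × I` submatrix is upper triangular with non-zero diagonal, hence nonsingular.
[folklore] -/
theorem card_le_rank_of_staircase {ι ι' : Type} [Fintype ι'] (R : Matrix ι ι' K) {ℓ : ℕ} (s : Fin ℓ → ι) (t : Fin ℓ → ι')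
    (I : Finset (Fin ℓ)) (hdiag : ∀ i ∈ I, R (s i) (t i) ≠ 0) (htri : ∀ i ∈ I, ∀ j ∈ I, j < i → R (s i) (t j) = 0) :
    I.card ≤ R.rank := by
  -- the `I × I` submatrix on rows `s` and columns `t`
  have hT : (R.submatrix (fun a : I => s a) (fun a : I => t a)).BlockTriangular id := by
    intro a b hab
    rw [Matrix.submatrix_apply]
    exact htri a a.2 b b.2 hab
  have hU : IsUnit (R.submatrix (fun a : I => s a) (fun a : I => t a)).det := by
    rw [Matrix.det_of_upperTriangular hT, isUnit_iff_ne_zero, Finset.prod_ne_zero_iff]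
    intro a _
    rw [Matrix.submatrix_apply]
    exact hdiag a a.2
  have h : Fintype.card I ≤ R.rank := card_le_rank_of_isUnit_det_submatrix R hU
  simpa only [Fintype.card_coe] using h

end Staircase

/-! ## Diagonal cells caught by a rectangle and separated by a double cut -/

section Caught

variable {K : Type} [Field K] {n n' : ℕ} {ι ι' : Type}

/-- **Caught cells.**  For a double cut `(A, A')` and a sign pattern `(σ, τ)`, the diagonal cells `(s i, t i)` of a weak staircase whose
row has pattern `(σ, τ)` and whose column has the opposite pattern lie in the rectangle `rect row col A A' σ τ D` and form a staircase
minor of it: their number is at most its rank. -/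
theorem card_filter_pattern_le_rank_rect [Fintype ι'] (row : ι → Fin n ⊕ Fin n' → Bool) (col : ι' → Fin n ⊕ Fin n' → Bool)
    (D : Matrix ι ι' K) {ℓ : ℕ} (s : Fin ℓ → ι) (t : Fin ℓ → ι')
    (hdiag : ∀ i : Fin ℓ, D (s i) (t i) ≠ 0) (htri : ∀ i j : Fin ℓ, j < i → D (s i) (t j) = 0)
    (A : Finset (Fin n → Bool)) (A' : Finset (Fin n' → Bool)) (σ τ : Bool) :
    (univ.filter fun i : Fin ℓ =>
        (decide (colourI (row (s i)) ∈ A) = σ ∧ decide (colourJ (row (s i)) ∈ A') = τ) ∧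
          (decide (colourI (col (t i)) ∈ A) = !σ ∧ decide (colourJ (col (t i)) ∈ A') = !τ)).card ≤
      (rect row col A A' σ τ D).rank := by
  refine card_le_rank_of_staircase (rect row col A A' σ τ D) s t _ (fun i hi => ?_) (fun i hi j hj hji => ?_)
  · rw [Finset.mem_filter] at hi
    rw [rect_apply, if_pos hi.2]
    exact hdiag i
  · rw [Finset.mem_filter] at hi hj
    rw [rect_apply, if_pos ⟨hi.2.1, hj.2.2⟩]
    exact htri i j hji

/-- **Separated cells.**  The number of diagonal cells of a weak staircase that the double cut `(A, A')` separates in BOTH families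
(row colour and column colour on different sides of `A`, and of `A'`) is at most `doubleCut A A' D`: partition them by the sign pattern
of the row and use `card_filter_pattern_le_rank_rect` and `doubleCut_eq_sum_four`. -/
theorem card_filter_sep_le_doubleCut [Fintype ι] [Fintype ι'] [DecidableEq ι] [DecidableEq ι']
    (row : ι → Fin n ⊕ Fin n' → Bool) (col : ι' → Fin n ⊕ Fin n' → Bool) (D : Matrix ι ι' K) {ℓ : ℕ} (s : Fin ℓ → ι) (t : Fin ℓ → ι')
    (hdiag : ∀ i : Fin ℓ, D (s i) (t i) ≠ 0) (htri : ∀ i j : Fin ℓ, j < i → D (s i) (t j) = 0)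
    (A : Finset (Fin n → Bool)) (A' : Finset (Fin n' → Bool)) :
    (univ.filter fun i : Fin ℓ =>
        decide (colourI (col (t i)) ∈ A) = !decide (colourI (row (s i)) ∈ A) ∧
          decide (colourJ (col (t i)) ∈ A') = !decide (colourJ (row (s i)) ∈ A')).card ≤
      doubleCut row col A A' D := by
  set S := univ.filter fun i : Fin ℓ =>
      decide (colourI (col (t i)) ∈ A) = !decide (colourI (row (s i)) ∈ A) ∧
        decide (colourJ (col (t i)) ∈ A') = !decide (colourJ (row (s i)) ∈ A') with hS
  -- partition the separated diagonal cells by the sign pattern of their row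
  have hfib : S.card = ∑ p : Bool × Bool,
      (S.filter fun i => (decide (colourI (row (s i)) ∈ A), decide (colourJ (row (s i)) ∈ A')) = p).card :=
    Finset.card_eq_sum_card_fiberwise
      (f := fun i => (decide (colourI (row (s i)) ∈ A), decide (colourJ (row (s i)) ∈ A')))
      (t := (univ : Finset (Bool × Bool))) (fun i _ => by simp)
  have hle : ∀ p : Bool × Bool,
      (S.filter fun i => (decide (colourI (row (s i)) ∈ A), decide (colourJ (row (s i)) ∈ A')) = p).card ≤
        (rect row col A A' p.1 p.2 D).rank := by
    rintro ⟨σ, τ⟩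
    refine le_trans (Finset.card_le_card fun i hi => ?_) (card_filter_pattern_le_rank_rect row col D s t hdiag htri A A' σ τ)
    simp only [hS, Finset.mem_filter, Finset.mem_univ, true_and, Prod.mk.injEq] at hi ⊢
    obtain ⟨⟨h1, h2⟩, h3, h4⟩ := hi
    exact ⟨⟨h3, h4⟩, by rw [h1, h3], by rw [h2, h4]⟩
  calc S.card = ∑ p : Bool × Bool,
        (S.filter fun i => (decide (colourI (row (s i)) ∈ A), decide (colourJ (row (s i)) ∈ A')) = p).card := hfib
    _ ≤ ∑ p : Bool × Bool, (rect row col A A' p.1 p.2 D).rank := Finset.sum_le_sum fun p _ => hle p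
    _ = doubleCut row col A A' D := by
      rw [doubleCut_eq_sum_four]
      simp only [Fintype.sum_prod_type, Fintype.sum_bool]

end Caught

/-! ## Counting double cuts -/

section Counting

/-- **Exactly half of all sets separate two distinct points.**  Toggling `p` is an involution of `Finset X` exchanging the sets `A`
with `(p' ∈ A) = ¬ (p ∈ A)` and those with `(p' ∈ A) = (p ∈ A)`, since `p' ≠ p` is not moved. [folklore] -/
theorem two_mul_card_filter_sep {X : Type} [Fintype X] [DecidableEq X] {p p' : X} (h : p ≠ p') :
    2 * (univ.filter fun A : Finset X => decide (p' ∈ A) = !decide (p ∈ A)).card = 2 ^ Fintype.card X := by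
  set S := univ.filter fun A : Finset X => decide (p' ∈ A) = !decide (p ∈ A) with hS
  set T := univ.filter fun A : Finset X => ¬ decide (p' ∈ A) = !decide (p ∈ A) with hT
  have hST : S.card + T.card = 2 ^ Fintype.card X := by
    rw [hS, hT, Finset.card_filter_add_card_filter_not, Finset.card_univ, Fintype.card_finset]
  -- membership in the toggled set `A ∆ {p}`
  have hp : ∀ A : Finset X, decide (p ∈ symmDiff A {p}) = !decide (p ∈ A) := by
    intro A
    by_cases hA : p ∈ A <;> simp [Finset.mem_symmDiff, hA]
  have hp's : p' ∉ ({p} : Finset X) := fun hm => h.symm (Finset.mem_singleton.mp hm)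
  have hp' : ∀ A : Finset X, decide (p' ∈ symmDiff A {p}) = decide (p' ∈ A) := by
    intro A
    by_cases hA : p' ∈ A <;> simp [Finset.mem_symmDiff, hA, hp's]
  have hbool : ∀ a b : Bool, ¬ a = !b → a = b := by decide
  have hbij : S.card = T.card := by
    refine Finset.card_bij (fun A _ => symmDiff A {p}) (fun A hA => ?_) (fun A₁ _ A₂ _ hA => ?_) (fun B hB => ?_)
    · simp only [hS, hT, Finset.mem_filter, Finset.mem_univ, true_and] at hA ⊢
      rw [hp, hp', hA, Bool.not_not]
      exact Bool.not_ne_self _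
    · exact symmDiff_left_injective _ hA
    · simp only [hS, hT, Finset.mem_filter, Finset.mem_univ, true_and] at hB ⊢
      refine ⟨symmDiff B {p}, ?_, symmDiff_symmDiff_cancel_right _ _⟩
      rw [hp, hp', Bool.not_not]
      exact hbool _ _ hB
  generalize 2 ^ Fintype.card X = N at hST
  omega

/-- **Double counting of a product indicator**: `Σ_{A ∈ S} Σ_{A' ∈ T} #{i | c i A ∧ d i A'} = Σ_i #{A ∈ S | c i A} · #{A' ∈ T | d i A'}`. -/
theorem sum_sum_card_filter_and {α β γ : Type} [Fintype γ] (S : Finset α) (T : Finset β) (c : γ → α → Prop) (d : γ → β → Prop)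
    [∀ i A, Decidable (c i A)] [∀ i A', Decidable (d i A')] :
    ∑ A ∈ S, ∑ A' ∈ T, (univ.filter fun i => c i A ∧ d i A').card = ∑ i, (S.filter (c i)).card * (T.filter (d i)).card := by
  simp only [Finset.card_filter, Finset.sum_mul_sum, ite_zero_mul_ite_zero, mul_one]
  exact (Finset.sum_congr rfl fun A _ => Finset.sum_comm).trans Finset.sum_comm

end Counting

/-! ## The registered stub -/

/-- **STAIRCASE CAP** (registered stub `stub_staircaseCap` of `Cruxes/RankDefectRepresentations/Lines/rank_dehn_ladder.lean`, lead g16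
RESHAPE 14, W14): a weak staircase of length `ℓ` — cells `(s i, t i)` with `D (s i) (t i) ≠ 0`, `D (s i) (t j) = 0` for `j < i`, and
`(s i, t j)` visible for `j ≤ i` — forces `ℓ · (2^{2^n} · 2^{2^{n'}}) ≤ 4 · Σ_{A,A'} doubleCut A A' D`, i.e. `ℓ ≤ 4 ē(D)`:
triangular rank certificates are capped by four times the average double cut. -/
theorem stub_staircaseCap :
    ∀ (K : Type) [Field K] (n n' : ℕ) (ι ι' : Type) [Fintype ι] [Fintype ι'] [DecidableEq ι] [DecidableEq ι']
      (row : ι → Fin n ⊕ Fin n' → Bool) (col : ι' → Fin n ⊕ Fin n' → Bool) (D : Matrix ι ι' K)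
      (ℓ : ℕ) (s : Fin ℓ → ι) (t : Fin ℓ → ι'),
      (∀ i j : Fin ℓ, j ≤ i →
        Summit.PneNP.PneNP.Theorems.CnfIdealGenLengthRankDefectRepresentationsTwoFamilyCutDomination.colourI (row (s i)) ≠
          Summit.PneNP.PneNP.Theorems.CnfIdealGenLengthRankDefectRepresentationsTwoFamilyCutDomination.colourI (col (t j)) ∧
        Summit.PneNP.PneNP.Theorems.CnfIdealGenLengthRankDefectRepresentationsTwoFamilyCutDomination.colourJ (row (s i)) ≠
          Summit.PneNP.PneNP.Theorems.CnfIdealGenLengthRankDefectRepresentationsTwoFamilyCutDomination.colourJ (col (t j))) →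
      (∀ i : Fin ℓ, D (s i) (t i) ≠ 0) →
      (∀ i j : Fin ℓ, j < i → D (s i) (t j) = 0) →
      ℓ * (2 ^ (2 ^ n) * 2 ^ (2 ^ n')) ≤
        4 * ∑ A : Finset (Fin n → Bool), ∑ A' : Finset (Fin n' → Bool),
          Summit.PneNP.PneNP.Theorems.CnfIdealGenLengthRankDefectRepresentationsTwoFamilyCutDomination.doubleCut row col A A' D := by
  intro K _ n n' ι ι' _ _ _ _ row col D ℓ s t hvis hdiag htri
  -- (1)+(2) pointwise: the diagonal cells separated by `(A, A')` number at most `doubleCut A A' D`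
  have hpt : ∀ (A : Finset (Fin n → Bool)) (A' : Finset (Fin n' → Bool)),
      (univ.filter fun i : Fin ℓ =>
          decide (colourI (col (t i)) ∈ A) = !decide (colourI (row (s i)) ∈ A) ∧
            decide (colourJ (col (t i)) ∈ A') = !decide (colourJ (row (s i)) ∈ A')).card ≤
        doubleCut row col A A' D :=
    fun A A' => card_filter_sep_le_doubleCut row col D s t hdiag htri A A'
  -- (3) each diagonal cell is visible, so exactly half of the first-family sets and half of the second-family sets separate it
  have hI : ∀ i : Fin ℓ, 2 * (univ.filter fun A : Finset (Fin n → Bool) =>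
      decide (colourI (col (t i)) ∈ A) = !decide (colourI (row (s i)) ∈ A)).card = 2 ^ (2 ^ n) := by
    intro i
    rw [two_mul_card_filter_sep (hvis i i le_rfl).1, Fintype.card_fun, Fintype.card_bool, Fintype.card_fin]
  have hJ : ∀ i : Fin ℓ, 2 * (univ.filter fun A' : Finset (Fin n' → Bool) =>
      decide (colourJ (col (t i)) ∈ A') = !decide (colourJ (row (s i)) ∈ A')).card = 2 ^ (2 ^ n') := by
    intro i
    rw [two_mul_card_filter_sep (hvis i i le_rfl).2, Fintype.card_fun, Fintype.card_bool, Fintype.card_fin]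
  -- double counting
  have hcount : ∑ A : Finset (Fin n → Bool), ∑ A' : Finset (Fin n' → Bool),
      (univ.filter fun i : Fin ℓ =>
          decide (colourI (col (t i)) ∈ A) = !decide (colourI (row (s i)) ∈ A) ∧
            decide (colourJ (col (t i)) ∈ A') = !decide (colourJ (row (s i)) ∈ A')).card =
      ∑ i : Fin ℓ,
        (univ.filter fun A : Finset (Fin n → Bool) =>
            decide (colourI (col (t i)) ∈ A) = !decide (colourI (row (s i)) ∈ A)).card *
          (univ.filter fun A' : Finset (Fin n' → Bool) =>
            decide (colourJ (col (t i)) ∈ A') = !decide (colourJ (row (s i)) ∈ A')).card :=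
    sum_sum_card_filter_and univ univ
      (fun (i : Fin ℓ) (A : Finset (Fin n → Bool)) => decide (colourI (col (t i)) ∈ A) = !decide (colourI (row (s i)) ∈ A))
      (fun (i : Fin ℓ) (A' : Finset (Fin n' → Bool)) => decide (colourJ (col (t i)) ∈ A') = !decide (colourJ (row (s i)) ∈ A'))
  -- (4) assemble
  calc ℓ * (2 ^ (2 ^ n) * 2 ^ (2 ^ n'))
      = ∑ _i : Fin ℓ, 2 ^ (2 ^ n) * 2 ^ (2 ^ n') := by
        rw [Finset.sum_const, Finset.card_univ, Fintype.card_fin, smul_eq_mul]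
    _ = ∑ i : Fin ℓ, 4 *
          ((univ.filter fun A : Finset (Fin n → Bool) =>
              decide (colourI (col (t i)) ∈ A) = !decide (colourI (row (s i)) ∈ A)).card *
            (univ.filter fun A' : Finset (Fin n' → Bool) =>
              decide (colourJ (col (t i)) ∈ A') = !decide (colourJ (row (s i)) ∈ A')).card) := by
        refine Finset.sum_congr rfl fun i _ => ?_
        rw [← hI i, ← hJ i]
        ring
    _ = 4 * ∑ A : Finset (Fin n → Bool), ∑ A' : Finset (Fin n' → Bool),
          (univ.filter fun i : Fin ℓ =>
              decide (colourI (col (t i)) ∈ A) = !decide (colourI (row (s i)) ∈ A) ∧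
                decide (colourJ (col (t i)) ∈ A') = !decide (colourJ (row (s i)) ∈ A')).card := by
        rw [hcount, Finset.mul_sum]
    _ ≤ 4 * ∑ A : Finset (Fin n → Bool), ∑ A' : Finset (Fin n' → Bool), doubleCut row col A A' D :=
        Nat.mul_le_mul_left 4 (Finset.sum_le_sum fun A _ => Finset.sum_le_sum fun A' _ => hpt A A')

end Summit.PneNP.PneNP.Theorems.CnfIdealGenLengthRankDefectRepresentationsStaircaseCap
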